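import Mathlib
import HarnessLib.Audit.Tags

/-!
# The instrument's normalisation of the pair-sum resultant (TODO-29 remainder (b2″-a); bus R314/R317)

Honest framing: an identity between two normalisations of one resultant, elementary and PROVED; no curve, no
Galois-image determination, no modularity claim, no new census, nothing numerical, no instrument touched; it says
nothing about any census member.  Mathlib-only (importable and checkable independently of the cell's olean lag).
Context.  The rung-23a instrument `res23.py` works with INTEGER objects: for an integer sextic `f` with leading
coefficient `lc`, the monic cubic `S̃(Y) = lc³·S(Y/lc) ∈ ℤ[Y]` (roots `lc·sᵢ`, `S` the monic cubic of the three pair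
sums `sᵢ`) and `G(Y, x) = Σ_k a_k·lc^{6−k}·(Y − lc·x)^k = lc⁶·f(Y/lc − x) ∈ ℤ[x][Y]`, and tests
`f ∣ R_inst := Norm_{ℤ[x][Y]/(S̃)}(G)`.  The typed chain (`ResultantCertificate.lean`, p372536;
`PairSumCertificate.lean`, p372254) starts instead from the RATIONAL Sylvester form
`F ∣ R := Res_Y(S(Y), F(Y − x))` (`Polynomial.resultant`, sizes `3, 6`, `F = toRatPoly f`).  This file types the
resultant-side half of the bridge between the two: with `lc := F.leadingCoeff`, `S' := S.map C` and
`g := (F.map C).comp (X − C X)` (`= F(Y − x)` in `ℚ[x][Y]`),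
* `S'.scaleRoots (C lc)` has `Yⁱ`-coefficient `Sᵢ·lc^{3−i}` (`coeff_instrumentCubic`) — the coefficients of
  `lc³·S(Y/lc) = S̃`;
* `C (C lc) · g.integralNormalization` has `Yⁱ`-coefficient `lc^{6−i}·gᵢ` (`coeff_instrumentSextic`) — the
  coefficients of `lc⁶·g(Y/lc) = lc⁶·F(Y/lc − x) = G`;
* `Res_Y(S̃, G) = lc¹⁸ · Res_Y(S', g)` at Sylvester sizes `3, 6` (`resultant_instrumentNormalisation_eq`, from
  Mathlib's `resultant_integralNormalization` and `resultant_C_mul_right`: `lc³ · lc^{3·5} = lc¹⁸`), hence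
  `F ∣ Res_Y(S̃, G) ↔ F ∣ Res_Y(S', g)` since `C lc¹⁸` is a unit of `ℚ[x]`
  (`dvd_resultant_instrumentNormalisation_iff`).
What remains UNTYPED after this file is (b2″-b) only: the instrument evaluates `Res_Y(S̃, G)` as the 3×3 NORM
determinant (multiplication by `G` on `ℤ[x][Y]/(S̃)`, basis `1, Y, Y²`), and «norm over a monic cubic = Sylvester
resultant» is not formalised here (nor is the trivial passage `ℤ[x] ⊂ ℚ[x]`).  A worked example
(`sanity_b2pp.py`, bus R316) checks `R_inst = lc¹⁸·R` exactly for `f = 64x⁶ + 32x⁴ − 8x³ + 8x² + 1`.  The exact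
statements were registered on the cell bus BEFORE any proof (R317, cell «pub-residmod», 2026-08-23).

Main results (all PROVED, axioms `propext`, `Classical.choice`, `Quot.sound` only):
* `resultant_instrumentNormalisation_eq`, `dvd_resultant_instrumentNormalisation_iff` — as above;
* `coeff_instrumentCubic`, `coeff_instrumentSextic` — the coefficient dictionary to the instrument's `S̃` and `G`.
-/

open Polynomial

namespace Summit.Ventures.ResidMod.Conjectures

/-- **(7) The instrument's normalisation differs from the rational Sylvester form by `lc¹⁸`.**  For
`F, S ∈ ℚ[X]` of degrees `6, 3`, `lc = F.leadingCoeff`, `S' = S.map C`, `g = F(Y − x)`: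
`Res_Y(S'.scaleRoots lc, lc·g.integralNormalization) = lc¹⁸ · Res_Y(S', g)` (Sylvester sizes `3, 6`).
Proof: `resultant_C_mul_right` (factor `lc³`) and `resultant_integralNormalization` (factor `lc^{3·5}`), the
sizes being the actual degrees (`natDegree_comp`, `leadingCoeff_comp`). [elementary commutative algebra] -/
theorem resultant_instrumentNormalisation_eq (F S : ℚ[X]) (hF6 : F.natDegree = 6) (hS3 : S.natDegree = 3) :
    resultant (((S.map (C : ℚ →+* ℚ[X])).scaleRoots (C F.leadingCoeff)))
        (C (C F.leadingCoeff) * ((F.map (C : ℚ →+* ℚ[X])).comp (X - C (X : ℚ[X]))).integralNormalization) 3 6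
      = C F.leadingCoeff ^ 18 *
        resultant (S.map (C : ℚ →+* ℚ[X])) ((F.map (C : ℚ →+* ℚ[X])).comp (X - C (X : ℚ[X]))) 3 6 := by
  set lc : ℚ := F.leadingCoeff with hlc
  set S' : ℚ[X][X] := S.map (C : ℚ →+* ℚ[X]) with hS'
  set g : ℚ[X][X] := (F.map (C : ℚ →+* ℚ[X])).comp (X - C (X : ℚ[X])) with hg
  have hCinj : Function.Injective (C : ℚ →+* ℚ[X]) := C_injective
  have hS'deg : S'.natDegree = 3 := by rw [hS', natDegree_map_eq_of_injective hCinj, hS3]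
  have hsub : (X - C (X : ℚ[X])).natDegree = 1 := natDegree_X_sub_C _
  have hgdeg : g.natDegree = 6 := by
    rw [hg, natDegree_comp, natDegree_map_eq_of_injective hCinj, hF6, hsub]
  have hglc : g.leadingCoeff = C lc := by
    rw [hg, leadingCoeff_comp (by rw [hsub]; exact one_ne_zero), leadingCoeff_map_of_injective hCinj,
      leadingCoeff_X_sub_C, one_pow, mul_one]
  have key := resultant_integralNormalization S' g (by rw [hgdeg]; norm_num)
  rw [natDegree_scaleRoots, natDegree_integralNormalization, hS'deg, hgdeg, hglc] at key
  rw [resultant_C_mul_right, key]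
  ring

/-- **(8) Divisibility is insensitive to the normalisation.**  Under the hypotheses of (7),
`F ∣ Res_Y(S̃, G) ↔ F ∣ Res_Y(S', g)`: `C lc¹⁸` is a unit of `ℚ[x]` (`lc ≠ 0` as `deg F = 6`). [bookkeeping] -/
theorem dvd_resultant_instrumentNormalisation_iff (F S : ℚ[X]) (hF6 : F.natDegree = 6) (hS3 : S.natDegree = 3) :
    F ∣ resultant (((S.map (C : ℚ →+* ℚ[X])).scaleRoots (C F.leadingCoeff)))
        (C (C F.leadingCoeff) * ((F.map (C : ℚ →+* ℚ[X])).comp (X - C (X : ℚ[X]))).integralNormalization) 3 6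
      ↔ F ∣ resultant (S.map (C : ℚ →+* ℚ[X])) ((F.map (C : ℚ →+* ℚ[X])).comp (X - C (X : ℚ[X]))) 3 6 := by
  have hF0 : F ≠ 0 := by rintro rfl; simp at hF6
  have hu : IsUnit (C F.leadingCoeff ^ 18 : ℚ[X]) :=
    (Polynomial.isUnit_C.mpr (isUnit_iff_ne_zero.mpr (leadingCoeff_ne_zero.mpr hF0))).pow 18
  rw [resultant_instrumentNormalisation_eq F S hF6 hS3]
  exact hu.dvd_mul_left

/-- **Dictionary (a).**  The scaled cubic `(S.map C).scaleRoots (C lc)` has `Yⁱ`-coefficient `Sᵢ · lc^(3 − i)`,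
i.e. it is `lc³·S(Y/lc)` — the instrument's `S̃` when `S` is the monic cubic of the pair sums. [bookkeeping] -/
theorem coeff_instrumentCubic (F S : ℚ[X]) (hS3 : S.natDegree = 3) (i : ℕ) :
    ((S.map (C : ℚ →+* ℚ[X])).scaleRoots (C F.leadingCoeff)).coeff i
      = C (S.coeff i * F.leadingCoeff ^ (3 - i)) := by
  rw [coeff_scaleRoots, coeff_map, natDegree_map_eq_of_injective C_injective, hS3, map_mul, map_pow]

/-- **Dictionary (b).**  `C (C lc) · g.integralNormalization` has `Yⁱ`-coefficient `lc^(6 − i) · gᵢ` for every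
`i` (`g = F(Y − x)`, `g₆ = lc`), i.e. it is `lc⁶·g(Y/lc) = lc⁶·F(Y/lc − x)` — the instrument's `G`. [bookkeeping] -/
theorem coeff_instrumentSextic (F : ℚ[X]) (hF6 : F.natDegree = 6) (i : ℕ) :
    (C (C F.leadingCoeff) * ((F.map (C : ℚ →+* ℚ[X])).comp (X - C (X : ℚ[X]))).integralNormalization).coeff i
      = C F.leadingCoeff ^ (6 - i) * ((F.map (C : ℚ →+* ℚ[X])).comp (X - C (X : ℚ[X]))).coeff i := by
  have hF0 : F ≠ 0 := by rintro rfl; simp at hF6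
  set lc : ℚ := F.leadingCoeff with hlc
  set g : ℚ[X][X] := (F.map (C : ℚ →+* ℚ[X])).comp (X - C (X : ℚ[X])) with hg
  have hCinj : Function.Injective (C : ℚ →+* ℚ[X]) := C_injective
  have hsub : (X - C (X : ℚ[X])).natDegree = 1 := natDegree_X_sub_C _
  have hgdeg : g.natDegree = 6 := by
    rw [hg, natDegree_comp, natDegree_map_eq_of_injective hCinj, hF6, hsub]
  have hglc : g.leadingCoeff = C lc := by
    rw [hg, leadingCoeff_comp (by rw [hsub]; exact one_ne_zero), leadingCoeff_map_of_injective hCinj,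
      leadingCoeff_X_sub_C, one_pow, mul_one]
  have hg0 : g ≠ 0 := by
    intro h; rw [h, natDegree_zero] at hgdeg; exact absurd hgdeg (by norm_num)
  rw [coeff_C_mul]
  by_cases hi : i = 6
  · subst hi
    have h6 : g.coeff 6 = C lc := by rw [← hglc, leadingCoeff, hgdeg]
    have hn : g.integralNormalization.coeff 6 = 1 := by
      rw [← hgdeg]; exact integralNormalization_coeff_natDegree hg0
    rw [hn, h6]; simp
  · rw [integralNormalization_coeff_ne_natDegree (by rw [hgdeg]; exact hi), hglc, hgdeg]
    rcases lt_or_gt_of_ne hi with hlt | hgt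
    · have h1 : 6 - i = (6 - 1 - i) + 1 := by omega
      rw [h1, pow_succ]; ring
    · have hz : g.coeff i = 0 := coeff_eq_zero_of_natDegree_lt (by rw [hgdeg]; exact hgt)
      simp [hz]

end Summit.Ventures.ResidMod.Conjectures
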